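import Mathlib
import Summits.PneNP.PneNP.Theorems.OverlapGapAlgebraSolvableImpliesStableSectionLipschitzTransferTypicalVariance

/-!
# PneNP / OverlapGapAlgebra — crux `SolvableImpliesStableSection` (stmt-PneNP-2463):
# the MEAN-SQUARE (ℓ²-stable) transfer (1/3) — variance and jump mass from one second moment

Support for crux `stmt-PneNP-2463` (`Summit.PneNP.PneNP.Theses.OverlapGapAlgebra.SolvableImpliesStableSection`).
The Lipschitz transfers (`sissLip_…`, `sissT_…`) control the solver's section `g` by a WORST-CASE
Hamming-Lipschitz constant per single-literal change. The notion of algorithmic stability used in the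
overlap-gap literature (Gamarnik–Jagannath–Wein 2020, "low degree ⇒ stable"; Bresler–Huang 2021,
Def. 2.4) is an AVERAGE one: the output moves little IN MEAN (square) when one coordinate of the input
is resampled. This file starts the transfer for that class. The single datum is the mean-square
single-literal-resample sensitivity
`S(g) = ∑_{(a,b)} ∑_{(Φ,ℓ)} d_H(g Φ, g Φ[(a,b) ↦ ℓ])²`
(sum over the `k m` literal positions, all instances and all replacement literals), and everything the
Bresler–Huang walk engine needs follows from it by second moments alone:

* `sissMS_efronStein_lit` — Efron–Stein over the `k m` LITERAL coordinates (the clause-coordinate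
  statement `es_efronStein` transported along `(Fin (m k) → literals) ≃ instances`);
* `sissMS_card_jump_le` — Markov on squares: `t² · #{(Φ,ℓ) : t < d_H(g Φ, g Φ[(a,b) ↦ ℓ])} ≤ ∑ d_H²`;
* `sissMS_sum_sq_dev_le` — the variance of the violated-clause count `V_g`:
  `2n · ∑_Φ (V_g Φ - μ)² ≤ (m k)·#Inst·2n + L²·S(g) + m²·(m k)·n·#{Φ : L < D Φ}`
  (bounded difference `(1 + d_H · D Φ)² ≤ 2 + 2 L² d_H²` at instances of maximum clause-degree
  `D Φ ≤ L`, the trivial `m²` elsewhere).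
No new definitions; axioms `propext`, `Classical.choice`, `Quot.sound`.
-/

set_option linter.dupNamespace false -- `Summit.PneNP.PneNP.…`: summit = sub-problem (D-0017)

namespace Summit.PneNP.PneNP.Theorems

open Finset Filter
open scoped Classical

section MeanSquare

variable {m k n : ℕ}

/-- **Efron–Stein over the literal coordinates (counting form).** For `1 ≤ n` and any
`f : instances → ℝ` on `F_k(n, m)`-instances (`m` clauses of `k` literals over `n` variables):
`2n · ∑_Φ (f Φ - μ)² ≤ ½ ∑_a ∑_b ∑_Φ ∑_ℓ (f Φ - f (Φ[(a,b) ↦ ℓ]))²`, `μ` the mean of `f`. -/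
theorem sissMS_efronStein_lit (hn : 1 ≤ n) (f : (Fin m → Fin k → Fin n × Bool) → ℝ) :
    (2 * n : ℝ) * ∑ Φ : Fin m → Fin k → Fin n × Bool,
        (f Φ - (∑ Ψ : Fin m → Fin k → Fin n × Bool, f Ψ)
          / Fintype.card (Fin m → Fin k → Fin n × Bool)) ^ 2
      ≤ (1 / 2 : ℝ) * ∑ a : Fin m, ∑ b : Fin k, ∑ Φ : Fin m → Fin k → Fin n × Bool,
          ∑ ℓ : Fin n × Bool, (f Φ - f (Function.update Φ a (Function.update (Φ a) b ℓ))) ^ 2 := by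
  haveI : Nonempty (Fin n × Bool) := ⟨(⟨0, hn⟩, true)⟩
  -- the currying equivalence between literal arrays and instances
  obtain ⟨e, he⟩ : ∃ e : (Fin (m * k) → Fin n × Bool) ≃ (Fin m → Fin k → Fin n × Bool),
      ∀ x a b, e x a b = x (finProdFinEquiv (a, b)) :=
    ⟨{ toFun := fun x a b => x (finProdFinEquiv (a, b))
       invFun := fun Φ t => Φ (finProdFinEquiv.symm t).1 (finProdFinEquiv.symm t).2
       left_inv := fun x => by funext t; simp only [Prod.mk.eta, Equiv.apply_symm_apply]
       right_inv := fun Φ => by funext a b; simp }, fun _ _ _ => rfl⟩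
  have hupd : ∀ (x : Fin (m * k) → Fin n × Bool) (a : Fin m) (b : Fin k) (c : Fin n × Bool),
      e (Function.update x (finProdFinEquiv (a, b)) c)
        = Function.update (e x) a (Function.update (e x a) b c) := by
    intro x a b c
    funext a' b'
    by_cases ha : a' = a
    · rw [ha, Function.update_self]
      by_cases hb : b' = b
      · rw [hb, Function.update_self, he, Function.update_self]
      · rw [Function.update_of_ne hb, he, he, Function.update_of_ne]
        exact fun h => hb (Prod.ext_iff.1 (finProdFinEquiv.injective h)).2
    · rw [Function.update_of_ne ha, he, he, Function.update_of_ne]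
      exact fun h => ha (Prod.ext_iff.1 (finProdFinEquiv.injective h)).1
  have hES : (Fintype.card (Fin n × Bool) : ℝ) * ∑ x : Fin (m * k) → Fin n × Bool,
      (f (e x) - (∑ y : Fin (m * k) → Fin n × Bool, f (e y))
        / Fintype.card (Fin (m * k) → Fin n × Bool)) ^ 2
      ≤ (1 / 2 : ℝ) * ∑ i : Fin (m * k), ∑ x : Fin (m * k) → Fin n × Bool, ∑ c : Fin n × Bool,
          (f (e x) - f (e (Function.update x i c))) ^ 2 :=
    Summit.PneNP.PneNP.Cruxes.SolvableImpliesStableSection.Sketch.es_efronStein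
      (C := Fin n × Bool) (m * k) (fun x => f (e x))
  -- left-hand side
  have hcardC : (Fintype.card (Fin n × Bool) : ℝ) = 2 * n := by
    rw [Fintype.card_prod, Fintype.card_fin, Fintype.card_bool]; push_cast; ring
  have hcardI : Fintype.card (Fin (m * k) → Fin n × Bool)
      = Fintype.card (Fin m → Fin k → Fin n × Bool) := Fintype.card_congr e
  have hsumf : ∑ y : Fin (m * k) → Fin n × Bool, f (e y)
      = ∑ Ψ : Fin m → Fin k → Fin n × Bool, f Ψ := Fintype.sum_equiv e _ _ (fun _ => rfl)
  have hL : ∑ x : Fin (m * k) → Fin n × Bool,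
      (f (e x) - (∑ y : Fin (m * k) → Fin n × Bool, f (e y))
        / Fintype.card (Fin (m * k) → Fin n × Bool)) ^ 2
      = ∑ Φ : Fin m → Fin k → Fin n × Bool,
        (f Φ - (∑ Ψ : Fin m → Fin k → Fin n × Bool, f Ψ)
          / Fintype.card (Fin m → Fin k → Fin n × Bool)) ^ 2 := by
    rw [hsumf, hcardI]
    exact Fintype.sum_equiv e _ _ (fun _ => rfl)
  -- right-hand side
  have hR : ∑ i : Fin (m * k), ∑ x : Fin (m * k) → Fin n × Bool, ∑ c : Fin n × Bool,
        (f (e x) - f (e (Function.update x i c))) ^ 2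
      = ∑ a : Fin m, ∑ b : Fin k, ∑ Φ : Fin m → Fin k → Fin n × Bool,
          ∑ ℓ : Fin n × Bool, (f Φ - f (Function.update Φ a (Function.update (Φ a) b ℓ))) ^ 2 := by
    have h1 : ∑ i : Fin (m * k), ∑ x : Fin (m * k) → Fin n × Bool, ∑ c : Fin n × Bool,
          (f (e x) - f (e (Function.update x i c))) ^ 2
        = ∑ q : Fin m × Fin k, ∑ x : Fin (m * k) → Fin n × Bool, ∑ c : Fin n × Bool,
          (f (e x) - f (e (Function.update x (finProdFinEquiv q) c))) ^ 2 :=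
      Fintype.sum_equiv finProdFinEquiv.symm _ _ (fun i => by simp only [Equiv.apply_symm_apply])
    have h2 : ∑ q : Fin m × Fin k, ∑ x : Fin (m * k) → Fin n × Bool, ∑ c : Fin n × Bool,
          (f (e x) - f (e (Function.update x (finProdFinEquiv q) c))) ^ 2
        = ∑ a : Fin m, ∑ b : Fin k, ∑ x : Fin (m * k) → Fin n × Bool, ∑ c : Fin n × Bool,
          (f (e x) - f (e (Function.update x (finProdFinEquiv (a, b)) c))) ^ 2 :=
      Fintype.sum_prod_type _
    rw [h1, h2]
    refine Finset.sum_congr rfl fun a _ => Finset.sum_congr rfl fun b _ => ?_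
    exact Fintype.sum_equiv e _ _ (fun x => by simp only [hupd])
  rw [hcardC, hL, hR] at hES
  exact hES

/-- **Markov on squares for the jump count.** For `0 ≤ t` and a literal position `(a, b)`:
`t² · #{(Φ, ℓ) : t < d_H(g Φ, g Φ[(a,b) ↦ ℓ])} ≤ ∑_{(Φ,ℓ)} d_H(g Φ, g Φ[(a,b) ↦ ℓ])²`. -/
theorem sissMS_card_jump_le (g : (Fin m → Fin k → Fin n × Bool) → (Fin n → Bool)) (t : ℝ)
    (ht : 0 ≤ t) (a : Fin m) (b : Fin k) :
    t ^ 2 * (((univ : Finset ((Fin m → Fin k → Fin n × Bool) × (Fin n × Bool))).filter fun p =>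
        t < hammingDist (g p.1) (g (Function.update p.1 a (Function.update (p.1 a) b p.2)))).card : ℝ)
      ≤ ∑ p : (Fin m → Fin k → Fin n × Bool) × (Fin n × Bool),
          (hammingDist (g p.1) (g (Function.update p.1 a (Function.update (p.1 a) b p.2))) : ℝ) ^ 2 := by
  set T := (univ : Finset ((Fin m → Fin k → Fin n × Bool) × (Fin n × Bool))).filter fun p =>
      t < hammingDist (g p.1) (g (Function.update p.1 a (Function.update (p.1 a) b p.2))) with hT
  calc t ^ 2 * (T.card : ℝ) = ∑ _p ∈ T, t ^ 2 := by rw [Finset.sum_const, nsmul_eq_mul, mul_comm]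
    _ ≤ ∑ p ∈ T, (hammingDist (g p.1)
        (g (Function.update p.1 a (Function.update (p.1 a) b p.2))) : ℝ) ^ 2 := by
        refine Finset.sum_le_sum fun p hp => ?_
        have hp' : t < hammingDist (g p.1)
            (g (Function.update p.1 a (Function.update (p.1 a) b p.2))) := by
          rw [hT, Finset.mem_filter] at hp
          exact hp.2
        exact pow_le_pow_left₀ ht hp'.le 2
    _ ≤ _ := Finset.sum_le_sum_of_subset_of_nonneg (Finset.subset_univ T) fun p _ _ => sq_nonneg _

/-- **Variance of the violated-clause count from the mean-square sensitivity (Efron–Stein over literals,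
with an exceptional set).** For `1 ≤ n`, every map `g` and every level `L`:
`2n · ∑_Φ (V_g Φ - μ)² ≤ (m k)·#Inst·2n + L² · S(g) + m²·(m k)·n · #{Φ : L < D Φ}`, where
`V_g Φ = #{i : clause i of Φ violated by g Φ}`, `S(g) = ∑_{(a,b)} ∑_{(Φ,ℓ)} d_H(g Φ, g Φ[(a,b) ↦ ℓ])²`
and `D Φ` is the maximum clause-degree. -/
theorem sissMS_sum_sq_dev_le (hn : 1 ≤ n) (g : (Fin m → Fin k → Fin n × Bool) → (Fin n → Bool))
    (L : ℕ) :
    (2 * n : ℝ) * ∑ Φ : Fin m → Fin k → Fin n × Bool,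
        ((((univ : Finset (Fin m)).filter fun i => ∀ j, g Φ (Φ i j).1 ≠ (Φ i j).2).card : ℝ)
          - (∑ Ψ : Fin m → Fin k → Fin n × Bool,
              (((univ : Finset (Fin m)).filter fun i => ∀ j, g Ψ (Ψ i j).1 ≠ (Ψ i j).2).card : ℝ))
            / Fintype.card (Fin m → Fin k → Fin n × Bool)) ^ 2
      ≤ ((m * k : ℕ) : ℝ) * Fintype.card (Fin m → Fin k → Fin n × Bool) * (2 * n)
        + (L : ℝ) ^ 2 * (∑ a : Fin m, ∑ b : Fin k,
            ∑ p : (Fin m → Fin k → Fin n × Bool) × (Fin n × Bool),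
              (hammingDist (g p.1) (g (Function.update p.1 a (Function.update (p.1 a) b p.2))) : ℝ) ^ 2)
        + (m : ℝ) ^ 2 * (((m * k : ℕ) : ℝ) * n)
          * (((univ : Finset (Fin m → Fin k → Fin n × Bool)).filter fun Φ =>
              L < (univ : Finset (Fin n)).sup fun v =>
                ((univ : Finset (Fin m)).filter fun i => ∃ j, (Φ i j).1 = v).card).card : ℝ) := by
  set N : ℝ := (Fintype.card (Fin m → Fin k → Fin n × Bool) : ℝ) with hN
  set f : (Fin m → Fin k → Fin n × Bool) → ℝ := fun Φ =>
    (((univ : Finset (Fin m)).filter fun i => ∀ j, g Φ (Φ i j).1 ≠ (Φ i j).2).card : ℝ) with hf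
  set Dn : (Fin m → Fin k → Fin n × Bool) → ℕ := fun Φ =>
    (univ : Finset (Fin n)).sup fun v =>
      ((univ : Finset (Fin m)).filter fun i => ∃ j, (Φ i j).1 = v).card with hDn
  set d : Fin m → Fin k → (Fin m → Fin k → Fin n × Bool) → (Fin n × Bool) → ℝ := fun a b Φ ℓ =>
    (hammingDist (g Φ) (g (Function.update Φ a (Function.update (Φ a) b ℓ))) : ℝ) with hd
  set Bad : ℝ := (((univ : Finset (Fin m → Fin k → Fin n × Bool)).filter fun Φ => L < Dn Φ).card : ℝ)
    with hBad
  have hcardC : (Fintype.card (Fin n × Bool) : ℝ) = 2 * n := by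
    rw [Fintype.card_prod, Fintype.card_fin, Fintype.card_bool]; push_cast; ring
  have hES := sissMS_efronStein_lit (m := m) (k := k) hn f
  -- per-term bounded differences
  have hbd : ∀ (a : Fin m) (b : Fin k) (Φ : Fin m → Fin k → Fin n × Bool) (ℓ : Fin n × Bool),
      (f Φ - f (Function.update Φ a (Function.update (Φ a) b ℓ))) ^ 2
        ≤ 2 + 2 * (L : ℝ) ^ 2 * d a b Φ ℓ ^ 2 + (m : ℝ) ^ 2 * (if L < Dn Φ then 1 else 0) := by
    intro a b Φ ℓ
    have hd0 : 0 ≤ d a b Φ ℓ := Nat.cast_nonneg _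
    have hx : 0 ≤ 2 * (L : ℝ) ^ 2 * d a b Φ ℓ ^ 2 := by positivity
    by_cases hL : L < Dn Φ
    · rw [if_pos hL, mul_one]
      have h1 : (f Φ - f (Function.update Φ a (Function.update (Φ a) b ℓ))) ^ 2 ≤ (m : ℝ) ^ 2 := by
        simp only [hf]
        exact sissT_violated_diff_sq_le_trivial g Φ _
      linarith only [h1, hx]
    · rw [if_neg hL, mul_zero, add_zero]
      have hΦ : (Dn Φ : ℝ) ≤ L := by exact_mod_cast not_lt.1 hL
      have h1 : (f Φ - f (Function.update Φ a (Function.update (Φ a) b ℓ))) ^ 2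
          ≤ (1 + d a b Φ ℓ * (Dn Φ : ℝ)) ^ 2 := by
        simp only [hf, hDn, hd]
        exact sissT_violated_diff_sq_le_of_hamming g
          (hammingDist (g Φ) (g (Function.update Φ a (Function.update (Φ a) b ℓ))) : ℝ)
          (Nat.cast_nonneg _) Φ a (Function.update (Φ a) b ℓ) le_rfl
      have hDD : 0 ≤ d a b Φ ℓ * (Dn Φ : ℝ) := mul_nonneg hd0 (Nat.cast_nonneg _)
      have h2 : (1 + d a b Φ ℓ * (Dn Φ : ℝ)) ^ 2 ≤ (1 + d a b Φ ℓ * L) ^ 2 := by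
        have : d a b Φ ℓ * (Dn Φ : ℝ) ≤ d a b Φ ℓ * L := mul_le_mul_of_nonneg_left hΦ hd0
        exact pow_le_pow_left₀ (by linarith only [hDD]) (by linarith only [this]) 2
      have h3 : (1 + d a b Φ ℓ * L) ^ 2 ≤ 2 + 2 * (L : ℝ) ^ 2 * d a b Φ ℓ ^ 2 := by
        nlinarith only [sq_nonneg (1 - d a b Φ ℓ * L)]
      linarith only [h1, h2, h3]
  -- the three sums, position by position
  have hinner : ∀ (a : Fin m) (b : Fin k),
      ∑ Φ : Fin m → Fin k → Fin n × Bool, ∑ ℓ : Fin n × Bool,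
          (f Φ - f (Function.update Φ a (Function.update (Φ a) b ℓ))) ^ 2
        ≤ 2 * (N * (2 * n))
          + 2 * (L : ℝ) ^ 2 * (∑ p : (Fin m → Fin k → Fin n × Bool) × (Fin n × Bool), d a b p.1 p.2 ^ 2)
          + (m : ℝ) ^ 2 * ((2 * n) * Bad) := by
    intro a b
    have e1 : ∑ _Φ : Fin m → Fin k → Fin n × Bool, ∑ _ℓ : Fin n × Bool, (2 : ℝ) = 2 * (N * (2 * n)) := by
      rw [Finset.sum_const, Finset.card_univ, Finset.sum_const, Finset.card_univ, nsmul_eq_mul,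
        nsmul_eq_mul, hcardC, hN]
      ring
    have e2 : ∑ Φ : Fin m → Fin k → Fin n × Bool, ∑ ℓ : Fin n × Bool,
          2 * (L : ℝ) ^ 2 * d a b Φ ℓ ^ 2
        = 2 * (L : ℝ) ^ 2 *
          (∑ p : (Fin m → Fin k → Fin n × Bool) × (Fin n × Bool), d a b p.1 p.2 ^ 2) := by
      have hp : ∑ p : (Fin m → Fin k → Fin n × Bool) × (Fin n × Bool), d a b p.1 p.2 ^ 2
          = ∑ Φ : Fin m → Fin k → Fin n × Bool, ∑ ℓ : Fin n × Bool, d a b Φ ℓ ^ 2 :=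
        Fintype.sum_prod_type' (fun Φ ℓ => d a b Φ ℓ ^ 2)
      rw [hp, Finset.mul_sum]
      refine Finset.sum_congr rfl fun Φ _ => ?_
      rw [Finset.mul_sum]
    have e3 : ∑ Φ : Fin m → Fin k → Fin n × Bool, ∑ _ℓ : Fin n × Bool,
          (m : ℝ) ^ 2 * (if L < Dn Φ then (1 : ℝ) else 0) = (m : ℝ) ^ 2 * ((2 * n) * Bad) := by
      have h1 : ∀ Φ : Fin m → Fin k → Fin n × Bool, ∑ _ℓ : Fin n × Bool,
          (m : ℝ) ^ 2 * (if L < Dn Φ then (1 : ℝ) else 0)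
            = (2 * n) * ((m : ℝ) ^ 2 * (if L < Dn Φ then (1 : ℝ) else 0)) := by
        intro Φ
        rw [Finset.sum_const, Finset.card_univ, nsmul_eq_mul, hcardC]
      simp only [h1]
      rw [← Finset.mul_sum, ← Finset.mul_sum, Finset.sum_boole, hBad]
      ring
    calc ∑ Φ : Fin m → Fin k → Fin n × Bool, ∑ ℓ : Fin n × Bool,
          (f Φ - f (Function.update Φ a (Function.update (Φ a) b ℓ))) ^ 2
        ≤ ∑ Φ : Fin m → Fin k → Fin n × Bool, ∑ ℓ : Fin n × Bool,
            ((2 : ℝ) + 2 * (L : ℝ) ^ 2 * d a b Φ ℓ ^ 2 + (m : ℝ) ^ 2 * (if L < Dn Φ then 1 else 0)) :=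
          Finset.sum_le_sum fun Φ _ => Finset.sum_le_sum fun ℓ _ => hbd a b Φ ℓ
      _ = ∑ _Φ : Fin m → Fin k → Fin n × Bool, ∑ _ℓ : Fin n × Bool, (2 : ℝ)
          + ∑ Φ : Fin m → Fin k → Fin n × Bool, ∑ ℓ : Fin n × Bool, 2 * (L : ℝ) ^ 2 * d a b Φ ℓ ^ 2
          + ∑ Φ : Fin m → Fin k → Fin n × Bool, ∑ _ℓ : Fin n × Bool,
              (m : ℝ) ^ 2 * (if L < Dn Φ then (1 : ℝ) else 0) := by
          simp only [Finset.sum_add_distrib]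
      _ = _ := by rw [e1, e2, e3]
  -- sum over the positions
  have houter : ∑ a : Fin m, ∑ b : Fin k, ∑ Φ : Fin m → Fin k → Fin n × Bool, ∑ ℓ : Fin n × Bool,
        (f Φ - f (Function.update Φ a (Function.update (Φ a) b ℓ))) ^ 2
      ≤ ((m * k : ℕ) : ℝ) * (2 * (N * (2 * n)))
        + 2 * (L : ℝ) ^ 2 * (∑ a : Fin m, ∑ b : Fin k,
            ∑ p : (Fin m → Fin k → Fin n × Bool) × (Fin n × Bool), d a b p.1 p.2 ^ 2)
        + ((m * k : ℕ) : ℝ) * ((m : ℝ) ^ 2 * ((2 * n) * Bad)) := by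
    calc ∑ a : Fin m, ∑ b : Fin k, ∑ Φ : Fin m → Fin k → Fin n × Bool, ∑ ℓ : Fin n × Bool,
          (f Φ - f (Function.update Φ a (Function.update (Φ a) b ℓ))) ^ 2
        ≤ ∑ a : Fin m, ∑ b : Fin k, (2 * (N * (2 * n))
          + 2 * (L : ℝ) ^ 2 * (∑ p : (Fin m → Fin k → Fin n × Bool) × (Fin n × Bool), d a b p.1 p.2 ^ 2)
          + (m : ℝ) ^ 2 * ((2 * n) * Bad)) :=
          Finset.sum_le_sum fun a _ => Finset.sum_le_sum fun b _ => hinner a b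
      _ = _ := by
          simp only [Finset.sum_add_distrib, Finset.sum_const, Finset.card_univ, Fintype.card_fin,
            nsmul_eq_mul, ← Finset.mul_sum]
          push_cast
          ring
  -- conclude
  have hfin : (2 * n : ℝ) * ∑ Φ : Fin m → Fin k → Fin n × Bool,
        (f Φ - (∑ Ψ : Fin m → Fin k → Fin n × Bool, f Ψ)
          / Fintype.card (Fin m → Fin k → Fin n × Bool)) ^ 2
      ≤ ((m * k : ℕ) : ℝ) * N * (2 * n)
        + (L : ℝ) ^ 2 * (∑ a : Fin m, ∑ b : Fin k,
            ∑ p : (Fin m → Fin k → Fin n × Bool) × (Fin n × Bool), d a b p.1 p.2 ^ 2)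
        + (m : ℝ) ^ 2 * (((m * k : ℕ) : ℝ) * n) * Bad := by
    have h := hES.trans (mul_le_mul_of_nonneg_left houter (by norm_num))
    have hrew : (1 / 2 : ℝ) * (((m * k : ℕ) : ℝ) * (2 * (N * (2 * n)))
        + 2 * (L : ℝ) ^ 2 * (∑ a : Fin m, ∑ b : Fin k,
            ∑ p : (Fin m → Fin k → Fin n × Bool) × (Fin n × Bool), d a b p.1 p.2 ^ 2)
        + ((m * k : ℕ) : ℝ) * ((m : ℝ) ^ 2 * ((2 * n) * Bad)))
        = ((m * k : ℕ) : ℝ) * N * (2 * n)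
          + (L : ℝ) ^ 2 * (∑ a : Fin m, ∑ b : Fin k,
              ∑ p : (Fin m → Fin k → Fin n × Bool) × (Fin n × Bool), d a b p.1 p.2 ^ 2)
          + (m : ℝ) ^ 2 * (((m * k : ℕ) : ℝ) * n) * Bad := by ring
    rw [hrew] at h
    exact h
  simpa only [hf, hd, hBad, hDn, hN] using hfin

end MeanSquare

end Summit.PneNP.PneNP.Theorems
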